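import Summits.BirchSwinnertonDyer.Rank1Residual.F1Sign2.LevelZeroSpinLawPosDiscAtTwo
import HarnessLib

/-!
# DESC-42 kernel — -desc g32's eleven glue theorems (Sketch42 v2 6a56ebed73a19d6d `### kernel glue`, VERBATIM) and REF1-AUDIT §274's probes K274.1/.2/.5/.8 (named) for
# `F1Sign2/LevelZeroSpinLawPosDiscAtTwo.lean` (typer -ty g21; kernel sibling per REF1 R274c)

CONTENT (all PROVED, no `sorry`, no new `def`): `nonIsolatedTripleAllEven_no_isolated_root` (egg-rescue cell ∩ isolated root = ∅), `eggRescueCell_not_off`, `eggRescueCell_not_good`,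
`eggRescueCell_not_rescuableAt`, `eggRescueCell_not_rescuableSharpAt`, **`pureSpinLawOfEggAlignedTriple_of_law42`** (DESC-42-D ⟹ DESC-42-A), **`spinObstructedOfMisalignedTriple_of_law42`**
(DESC-42-D ⟹ DESC-42-B), `law42_eggRescueCell_iff` (under 42-D, in the egg-rescue cell PURE ⟺ ALIGNED — the dichotomy kit job42 tests), `law42_lone_off_pure` (42-D contains
DESC-41-A at the lone place), `selmerTwoCard_ne_one_of_aligned_allOff` (THM 42.2 read as visibility: everywhere sharp-OFF + aligned ⟹ `Sel₂ ≠ 0`, from DESC-42-T),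
`eggRescueCell_not_oneRoot` (v2: T″'s one-root hypothesis is disjoint from the egg-rescue cell); REF1: `eggRescueCell_no_isolated_root` (K274.1), `nonIsolatedTripleAllEven_not_odd`
(K274.2), `isNormOneUnitAtTwo_one` (K274.5, carrier non-vacuity), `not_rescuableAt_of_oneRoot_conductorOdd` (K274.8).  REF1 A1: axioms of `law42_eggRescueCell_iff`,
`spinObstructedOfMisalignedTriple_of_law42`, `selmerTwoCard_ne_one_of_aligned_allOff` = propext / Classical.choice / Quot.sound.  PORT GATE = REF1-AUDIT §274 (2026-08-29T23:36:53Z).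
BSD is not proved by this; 23715 is not closed by this.
-/

open scoped Classical

open WeierstrassCurve Literature.NumberTheory.EllipticCurves Literature.NumberTheory.DiophantineGeometry Polynomial IsDedekindDomain NumberField

namespace Summit.BirchSwinnertonDyer.Rank1Residual.F1Sign2

/-- The egg-rescue cell is disjoint from THM 40.1's isolated-root rescue cell (an isolated root has `m = 4 < 5`). -/
theorem nonIsolatedTripleAllEven_no_isolated_root (F : ℤ[X]) (h : NonIsolatedTripleAllEvenAtTwo F) : ¬ ∃ e : ℤ, HenselDatumAtTwo F e 4 := by
  rintro ⟨e, he⟩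
  have := (h.2.2 e 4 he).2
  omega

/-- In the egg-rescue cell the place is not sharp-OFF. -/
theorem eggRescueCell_not_off (W : WeierstrassCurve ℚ) (c F : ℤ[X]) (v₀ : HeightOneSpectrum (𝓞 ℚ)) (h : EggRescueCellAtTwo W c F v₀) :
    ¬ SwitchedOffSharpAt W c F v₀ 2 :=
  fun hoff => not_switchedOnSharpAt_of_off W c F v₀ 2 hoff h.1

/-- In the egg-rescue cell the place is not good (good reduction is THM 39.1's first OFF cell). -/
theorem eggRescueCell_not_good (W : WeierstrassCurve ℚ) (c F : ℤ[X]) (v₀ : HeightOneSpectrum (𝓞 ℚ)) (h : EggRescueCellAtTwo W c F v₀) :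
    ¬ W.HasGoodReductionAt v₀ :=
  fun hg => h.1.1 (Or.inl hg)

/-- In the egg-rescue cell the place is not LAW 40-rescuable (one local root contradicts three; split multiplicative contradicts not multiplicative). -/
theorem eggRescueCell_not_rescuableAt (W : WeierstrassCurve ℚ) (c F : ℤ[X]) (v₀ : HeightOneSpectrum (𝓞 ℚ)) (h : EggRescueCellAtTwo W c F v₀) :
    ¬ RescuableAt W c F v₀ 2 := by
  rintro (⟨hone, -⟩ | ⟨-, hsplit, -⟩)
  · exact hone.2 h.2.2.1.2
  · exact h.2.1 hsplit.hasMultiplicativeReductionAt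

/-- In the egg-rescue cell the place is not sharp-rescuable (the additive disjunct needs an isolated root, `m = 4 < 5`). -/
theorem eggRescueCell_not_rescuableSharpAt (W : WeierstrassCurve ℚ) (c F : ℤ[X]) (v₀ : HeightOneSpectrum (𝓞 ℚ)) (h : EggRescueCellAtTwo W c F v₀) :
    ¬ RescuableSharpAt W c F v₀ 2 := by
  rintro (hr | ⟨-, -, -, -, hiso, -⟩)
  · exact eggRescueCell_not_rescuableAt W c F v₀ h hr
  · exact nonIsolatedTripleAllEven_no_isolated_root F h.2.2.2 hiso

/-- **DESC-42-D ⟹ DESC-42-A** (kernel). -/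
theorem pureSpinLawOfEggAlignedTriple_of_law42 (hlaw : LevelZeroSpinLawPosDiscLoneAdditiveTwoAtTwo) : PureSpinLawOfEggAlignedTripleAtTwo := by
  intro W _ _ _ c xnum xden B2 B4 B6 hc hb hs ho hpos hal v₀ hv₀ hoth hcell
  exact (hlaw W c xnum xden B2 B4 B6 hc hb hs ho hpos v₀ hv₀ hcell.2.1 hoth).mpr (Or.inr (Or.inr ⟨hcell, hal⟩))

/-- **DESC-42-D ⟹ DESC-42-B** (kernel). -/
theorem spinObstructedOfMisalignedTriple_of_law42 (hlaw : LevelZeroSpinLawPosDiscLoneAdditiveTwoAtTwo) : SpinObstructedOfMisalignedTripleAtTwo := by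
  intro W _ _ _ c xnum xden B2 B4 B6 hc hb hs ho hpos hnal v₀ hv₀ hoth hcell hfit
  rcases (hlaw W c xnum xden B2 B4 B6 hc hb hs ho hpos v₀ hv₀ hcell.2.1 hoth).mp hfit with hoff | hresc | ⟨-, hal⟩
  · exact eggRescueCell_not_off W c _ v₀ hcell hoff
  · exact eggRescueCell_not_rescuableSharpAt W c _ v₀ hcell hresc
  · exact hnal hal

/-- Under DESC-42-D, in the egg-rescue cell PURE ⟺ ALIGNED (the dichotomy kit job42 tests). -/
theorem law42_eggRescueCell_iff (hlaw : LevelZeroSpinLawPosDiscLoneAdditiveTwoAtTwo)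
    (W : WeierstrassCurve ℚ) [W.IsElliptic] [W.IsGloballyMinimal] [Fact (Irreducible (twoDivisionUCubic W))] (c xnum : ℤ[X]) (xden : ℕ) (B2 B4 B6 : ℤ)
    (hc : CubicDatumFor W c xnum xden) (hb : BInvariantsZ W B2 B4 B6) (hs : selmerTwoCard W = 1) (ho : DegOnePrimesOddClassC c) (hpos : 0 < cubicDiscZ c)
    (v₀ : HeightOneSpectrum (𝓞 ℚ)) (hv₀ : PlaceOver v₀ 2)
    (hoth : ∀ (w : HeightOneSpectrum (𝓞 ℚ)) (ℓ : ℕ), PlaceOver w ℓ → w ≠ v₀ → SwitchedOffSharpAt W c (twoDivisionCubicZ B2 B4 B6) w ℓ)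
    (hcell : EggRescueCellAtTwo W c (twoDivisionCubicZ B2 B4 B6) v₀) :
    CorrectedSpinLawFits W c xnum xden [] ↔ EggAlignedUnitsAtTwo W :=
  ⟨fun hfit => by
    by_contra hnal
    exact spinObstructedOfMisalignedTriple_of_law42 hlaw W c xnum xden B2 B4 B6 hc hb hs ho hpos hnal v₀ hv₀ hoth hcell hfit,
   fun hal => pureSpinLawOfEggAlignedTriple_of_law42 hlaw W c xnum xden B2 B4 B6 hc hb hs ho hpos hal v₀ hv₀ hoth hcell⟩

/-- **DESC-42-D contains DESC-41-A at the lone place** (kernel): a sharp-OFF non-multiplicative `v₀ ∣ 2` with every other place sharp-OFF is pure. -/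
theorem law42_lone_off_pure (hlaw : LevelZeroSpinLawPosDiscLoneAdditiveTwoAtTwo)
    (W : WeierstrassCurve ℚ) [W.IsElliptic] [W.IsGloballyMinimal] [Fact (Irreducible (twoDivisionUCubic W))] (c xnum : ℤ[X]) (xden : ℕ) (B2 B4 B6 : ℤ)
    (hc : CubicDatumFor W c xnum xden) (hb : BInvariantsZ W B2 B4 B6) (hs : selmerTwoCard W = 1) (ho : DegOnePrimesOddClassC c) (hpos : 0 < cubicDiscZ c)
    (v₀ : HeightOneSpectrum (𝓞 ℚ)) (hv₀ : PlaceOver v₀ 2) (hm : ¬ W.HasMultiplicativeReductionAt v₀)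
    (hoth : ∀ (w : HeightOneSpectrum (𝓞 ℚ)) (ℓ : ℕ), PlaceOver w ℓ → w ≠ v₀ → SwitchedOffSharpAt W c (twoDivisionCubicZ B2 B4 B6) w ℓ)
    (hoff : SwitchedOffSharpAt W c (twoDivisionCubicZ B2 B4 B6) v₀ 2) : CorrectedSpinLawFits W c xnum xden [] :=
  (hlaw W c xnum xden B2 B4 B6 hc hb hs ho hpos v₀ hv₀ hm hoth).mpr (Or.inl hoff)

/-- THM 42.2 read as VISIBILITY: everywhere sharp-OFF, `Δ_L > 0`, `h_L` odd, aligned units ⟹ `Sel₂(W) ≠ 0` (contrapositive of DESC-42-T). -/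
theorem selmerTwoCard_ne_one_of_aligned_allOff (hT : NotEggAlignedOfAllSwitchedOffSharpAtTwo)
    (W : WeierstrassCurve ℚ) [W.IsElliptic] [W.IsGloballyMinimal] [Fact (Irreducible (twoDivisionUCubic W))] (c xnum : ℤ[X]) (xden : ℕ) (B2 B4 B6 : ℤ)
    (hc : CubicDatumFor W c xnum xden) (hb : BInvariantsZ W B2 B4 B6) (ho : DegOnePrimesOddClassC c) (hpos : 0 < cubicDiscZ c)
    (hoff : ∀ (v : HeightOneSpectrum (𝓞 ℚ)) (ℓ : ℕ), PlaceOver v ℓ → SwitchedOffSharpAt W c (twoDivisionCubicZ B2 B4 B6) v ℓ)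
    (hal : EggAlignedUnitsAtTwo W) : selmerTwoCard W ≠ 1 :=
  fun hs => hT W c xnum xden B2 B4 B6 hc hb hs ho hpos hoff hal

/-- Under DESC-42-T″'s hypotheses the lone place is not in the egg-rescue cell (that cell needs three local roots): LAW 42 predicts
`¬ pure` there independently of alignment, and T″ says alignment does not even occur. -/
theorem eggRescueCell_not_oneRoot (W : WeierstrassCurve ℚ) (c F : ℤ[X]) (v₀ : HeightOneSpectrum (𝓞 ℚ))
    (h : EggRescueCellAtTwo W c F v₀) (h1 : OneLocalRootC c 2) : False :=
  h1.2 h.2.2.1.2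

/-! ### REF1-AUDIT §274 kernel probes (`REF1-data/b274/Probe274v2.lean` dc5ec7b03100b47b, block `REF1_274`, K274.1/.2/.5/.8; the `example`s named as theorems by the typer) -/

/-- K274.1 (REF1 §274): the egg-rescue cell (DESC-42-A/B) and DESC-42-T′'s isolated-root cell `HenselDatumAtTwo F e 4` are DISJOINT. -/
theorem eggRescueCell_no_isolated_root (W : WeierstrassCurve ℚ) (c F : ℤ[X]) (v₀ : HeightOneSpectrum (𝓞 ℚ))
    (h : EggRescueCellAtTwo W c F v₀) (h4 : ∃ e : ℤ, HenselDatumAtTwo F e 4) : False :=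
  nonIsolatedTripleAllEven_no_isolated_root F h.2.2.2 h4

/-- K274.2 (REF1 §274): in the egg-rescue cell every Hensel multiplicity is even (odd `m`, i.e. the (1,1)/(2,1) cells, excluded). -/
theorem nonIsolatedTripleAllEven_not_odd (F : ℤ[X]) (h : NonIsolatedTripleAllEvenAtTwo F) (e : ℤ) (m : ℕ) (hd : HenselDatumAtTwo F e m)
    (ho : Odd m) : False :=
  (Nat.not_even_iff_odd.mpr ho) (h.2.2 e m hd).1

/-- K274.5 (REF1 §274, BC7-a): the carrier `IsNormOneUnitAtTwo` is inhabited by `1` in every two-division algebra, so `EggAlignedUnitsAtTwo W` quantifies over a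
NONEMPTY set — its truth value is decided by the sign types, not by vacuity (and for `Δ_W < 0` it is FALSE identically: keep `0 < cubicDiscZ c` next to every use, R274c). -/
theorem isNormOneUnitAtTwo_one (W : WeierstrassCurve ℚ) : IsNormOneUnitAtTwo W 1 := ⟨isIntegral_one, map_one _⟩

/-- K274.8 (REF1 §274): DESC-42-T″'s conductor hypothesis is literally the negation of LAW 40's one-root rescue disjunct. -/
theorem not_rescuableAt_of_oneRoot_conductorOdd (W : WeierstrassCurve ℚ) (c F : ℤ[X]) (v : HeightOneSpectrum (𝓞 ℚ)) (h1 : OneLocalRootC c 2)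
    (hodd : ConductorOddAboveOneRoot F 2) : ¬ RescuableAt W c F v 2 := by
  rintro (⟨-, hev⟩ | ⟨h3', -⟩)
  · exact hev hodd
  · exact h1.2 h3'.2

end Summit.BirchSwinnertonDyer.Rank1Residual.F1Sign2
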